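import Literature.NumberTheory.EllipticCurves.PAdicBSDInterpolationProofs
import Literature.NumberTheory.EllipticCurves.PAdicLFunctionNeZeroHoldsProofs
import Literature.NumberTheory.EllipticCurves.KatoTwistedFinitenessQuadraticTwistEvenProofs
import Literature.NumberTheory.EllipticCurves.QuadraticTwistTwoLFunctionProofs
import Literature.NumberTheory.EllipticCurves.LFunctionPrimeCoeff
import Mathlib.NumberTheory.Padics.MahlerBasis
import HarnessLib

/-!
# The sign-forced zero of the `2`-adic `L`-function at `T = −2`: `(T + 2) ∣ L₂(E, T)` when
# `L(E^{(2)}, 1) = 0` — Mazur–Tate–Teitelbaum interpolation at the conductor-`8` character, PROOFS ONLY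

Topic `NumberTheory/EllipticCurves`; literature seat `bsd-rank2-lit` (cell `bsd-rank2`, gen 15), at the
request of the cell's planner `p2` GEN 14 (route `TwoAdicLambdaTransport`, authorised by director-bsd g6
2026-08-27; memo `run/shared/lean/pub/bsd-rank2/p2/PADIC-R2-G14.md` §4, crux `ZeroAtMinusTwo` = line item
K_F6 of `p2/g14/SketchG14.lean`, and clause (ii) of the toy certificate `p2/g14/Toy675255.lean`):
«MTT interpolation at the conductor-8 character». No definition and no named fact is introduced
(D-0026); every input is a tree THEOREM:

* the Mazur–Swinnerton-Dyer / Mazur–Tate–Teitelbaum interpolation property of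
  `L_p(E, T) = padicLFunction f (unitRoot W p)` at the characters of conductor `p^m`
  (`hasSum_coeff_padicLFunction_unitRoot`, file `PAdicBSDInterpolationProofs`; MTT §I.14);
* Birch's formula `(∑_{a mod m} χ(a)[a/m]⁺_f) · Ω⁺_f = τ(χ) · L(f, χ̄, 1)` for even primitive `χ`
  (`ratTwistedSymbolSum_mul_plusPeriod_holds`; MTT §I.8 (8.6)) and `Ω⁺_f > 0`
  (`IsNewform0.plusPeriod_pos_holds`);
* `aₙ(E^{(2)}) = χ₈(n) aₙ(E)` for `E` good at `2` (`LFunction_quadraticTwist_two_apply_complex`), the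
  primitivity of `χ₈ = (2/·)` mod `8`, and the entire continuation of `L(f ⊗ χ, s)`
  (`hasEntireLFunction_of_coeff_of_isPrimitive`, Shimura Prop. 3.64 / Hecke).

## What is proved

* §1 `PadicInt.X_sub_C_dvd_of_hasSum_zero` — **evaluation ⇒ divisibility in `ℤ_p⟦X⟧`**: for
  `g ∈ ℤ_p⟦X⟧`, `|a| < 1` and `∑_k g_k a^k = 0` (convergent in `ℤ_p`), `(X − a) ∣ g`
  (`g = (X − a) · h`, `h_i = ∑_k g_{i+1+k} a^k`).
* §2 the character `χ₈ ⊗ R` (`ZMod.χ₈` composed with `ℤ → R`, `R` of characteristic `0`): even,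
  `χ₈(5) = −1`, primitive of conductor `8`, of order `2`; the tree's cyclotomic variable at `p = 2`
  has `γ = cyclotomicGenerator 2 = 5`, so `χ₈` sits at `T = χ₈(γ) − 1 = −2`.
* §3 `hasSum_coeff_padicLFunction_two_neg_two` — **MTT at `χ₈`**: for `E/ℚ` good ordinary at `2`
  with newform `f` and unit root `α`, `∑_k c_k (−2)^k = α⁻³ · S₈(f)` in `ℂ₂`, where
  `L₂(E, T) = ∑ c_k T^k` and `S₈(f) = ∑_{a mod 8} χ₈(a) [a/8]⁺_f ∈ ℚ`
  (`ratTwistedSymbolSum_χ₈_eq_cast`: the `ℂ₂`- and `ℂ`-valued sums are the images of one rational).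
* §4 `ratTwistedSymbolSum_χ₈_eq_zero_of_analyticRank_ne_zero` — **`L(E^{(2)}, 1) = 0 ⇒ S₈(f) = 0`**
  for `E` good at `2` (Birch's formula for `χ₈`, `L(f, χ₈, s) = L(E^{(2)}, s)`, `Ω⁺_f ≠ 0`).
* §5 `hasSum_coeff_padicLFunction_two_neg_two_zero`, and the headline
  `X_add_C_two_dvd_of_analyticRank_quadraticTwist_two_ne_zero` — **for `E/ℚ` globally minimal,
  good ordinary at `2`, with `ord_{s=1} L(E^{(2)}, s) ≠ 0` (e.g. `w(E^{(2)}) = −1`), every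
  integral multiple `g ∈ ℤ₂⟦T⟧` of `L₂(E, T)` (`g = c · L₂(E, T)`, `c ∈ ℚ₂`) is divisible by
  `T + 2`.** This is p2's crux `ZeroAtMinusTwo` member-wise, from its support `RootNumberFacts`
  (`(twistTwo j n).analyticRank % 2 = 1`, `twistTwo j n = (curve j n).quadraticTwist 2`) and
  `FamilyFacts` (`IsOrdinaryAt (curve j n) 2`); and clause (ii) of `ToyAnalyticCertificate`.

References: B. Mazur, J. Tate, J. Teitelbaum, *On `p`-adic analogues of the conjectures of Birch and
Swinnerton-Dyer*, Invent. Math. **84** (1986), §I.8 (8.6), §I.13, §I.14 Proposition (p. 20)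
[bib `MazurTateTeitelbaum1986Invent`]; W. Stein, C. Wuthrich, *Algorithms for the arithmetic of
elliptic curves using Iwasawa theory*, Math. Comp. **82** (2013), §3 (the variable `T`, finite-order
characters of `Γ`) [bib `SteinWuthrich2013`]; G. Shimura, *Introduction to the arithmetic theory of
automorphic functions* (1971), Prop. 3.64 [bib `Shimura1971`].
-/

noncomputable section

open scoped MatrixGroups ModularForm

open CongruenceSubgroup PowerSeries Filter Topology
  Literature.NumberTheory.EllipticCurves.ModularForms IsDedekindDomain NumberField Rat.HeightOneSpectrum

namespace Literature.NumberTheory.EllipticCurves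

/-! ### §1 Evaluation and divisibility in `ℤ_p⟦X⟧` -/

section PowerSeriesPadic

variable {p : ℕ} [Fact p.Prime]

/-- For `g ∈ ℤ_p⟦X⟧` and `|a| < 1` the tail series `∑_k g_{i+k} a^k` converges in `ℤ_p`
(its terms tend to `0`; a complete nonarchimedean group). [folklore] -/
private theorem PadicInt.summable_coeff_add_mul_pow (g : PowerSeries ℤ_[p]) {a : ℤ_[p]}
    (ha : ‖a‖ < 1) (i : ℕ) : Summable (fun k : ℕ ↦ coeff (i + k) g * a ^ k) := by
  refine NonarchimedeanAddGroup.summable_of_tendsto_cofinite_zero ?_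
  rw [Nat.cofinite_eq_atTop]
  have h0 : Tendsto (fun k : ℕ ↦ ‖a‖ ^ k) atTop (𝓝 0) :=
    tendsto_pow_atTop_nhds_zero_of_lt_one (norm_nonneg a) ha
  refine squeeze_zero_norm (fun k ↦ ?_) h0
  calc ‖coeff (i + k) g * a ^ k‖ ≤ ‖coeff (i + k) g‖ * ‖a ^ k‖ := norm_mul_le _ _
    _ ≤ 1 * ‖a‖ ^ k := by
        gcongr
        · exact PadicInt.norm_le_one _
        · exact norm_pow_le a k
    _ = ‖a‖ ^ k := one_mul _

/-- The series `∑_k g_k a^k` of `g ∈ ℤ_p⟦X⟧` at `|a| < 1` converges in `ℤ_p`.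
[cite: MazurTateTeitelbaum1986Invent, §I.13] -/
theorem PadicInt.summable_coeff_mul_pow (g : PowerSeries ℤ_[p]) {a : ℤ_[p]} (ha : ‖a‖ < 1) :
    Summable (fun k : ℕ ↦ coeff k g * a ^ k) := by
  simpa using PadicInt.summable_coeff_add_mul_pow g ha 0

/-- **Evaluation and divisibility in `ℤ_p⟦X⟧`.** If `g ∈ ℤ_p⟦X⟧`, `a ∈ ℤ_p` with `|a| < 1`, and
`g(a) = ∑_k g_k a^k = 0` (a convergent series in `ℤ_p`), then `X − a` divides `g` in `ℤ_p⟦X⟧`: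
`g = (X − a) · h` with `h_i = ∑_k g_{i+1+k} a^k` (the elementary case of the `p`-adic Weierstrass
division theorem, Washington Prop. 7.2, for the distinguished polynomial `X − a`).
[cite: Washington1997, Prop. 7.2] -/
theorem PadicInt.X_sub_C_dvd_of_hasSum_zero {g : PowerSeries ℤ_[p]} {a : ℤ_[p]} (ha : ‖a‖ < 1)
    (h : HasSum (fun k : ℕ ↦ coeff k g * a ^ k) 0) :
    (X - C a) ∣ g := by
  have hs := PadicInt.summable_coeff_add_mul_pow g ha
  -- the shifted tail: `∑_k g_{i+k+1} a^{k+1} = (∑_k g_{i+1+k} a^k) · a`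
  have hshift : ∀ i : ℕ, ∑' k, coeff (i + (k + 1)) g * a ^ (k + 1) =
      (∑' k, coeff (i + 1 + k) g * a ^ k) * a := fun i ↦ by
    rw [← (hs (i + 1)).tsum_mul_right]
    refine tsum_congr fun k ↦ ?_
    rw [pow_succ, ← mul_assoc, show i + (k + 1) = i + 1 + k by omega]
  -- splitting off the first term: `∑_k g_{i+k} a^k = g_i + (∑_k g_{i+1+k} a^k) · a`
  have hsplit : ∀ i : ℕ, ∑' k, coeff (i + k) g * a ^ k =
      coeff i g + (∑' k, coeff (i + 1 + k) g * a ^ k) * a := fun i ↦ by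
    rw [(hs i).tsum_eq_zero_add, pow_zero, mul_one, add_zero, hshift]
  refine ⟨PowerSeries.mk fun i ↦ ∑' k, coeff (i + 1 + k) g * a ^ k, ?_⟩
  ext n
  rw [sub_mul, map_sub, coeff_C_mul, coeff_mk]
  cases n with
  | zero =>
    rw [coeff_zero_X_mul, zero_sub, mul_comm a]
    have h0 := hsplit 0
    simp only [zero_add] at h0 ⊢
    rw [h.tsum_eq] at h0
    linear_combination -h0
  | succ m =>
    rw [coeff_succ_X_mul, coeff_mk, hsplit (m + 1), mul_comm a]
    ring

end PowerSeriesPadic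

/-! ### §2 The character `χ₈ = (2/·)` with values in a ring of characteristic zero -/

section ChiEight

variable (R : Type*) [CommRing R]

/-- `χ₈ ⊗ R` is even: `χ₈(−1) = χ₈(7) = 1`. [folklore] -/
private theorem χ₈_ringHomComp_even :
    DirichletCharacter.Even (ZMod.χ₈.ringHomComp (Int.castRingHom R)) := by
  show (ZMod.χ₈.ringHomComp (Int.castRingHom R)) (-1) = 1
  rw [MulChar.ringHomComp_apply]
  have h : ZMod.χ₈ (-1 : ZMod 8) = 1 := by decide
  rw [h, map_one]

/-- `χ₈ ⊗ R` takes the value `−1` at `5`. [folklore] -/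
private theorem χ₈_ringHomComp_five :
    (ZMod.χ₈.ringHomComp (Int.castRingHom R)) (5 : ZMod 8) = -1 := by
  rw [MulChar.ringHomComp_apply]
  have h : ZMod.χ₈ (5 : ZMod 8) = -1 := by decide
  rw [h, map_neg, map_one]

/-- A Dirichlet character mod `8` with values in a ring of characteristic `0` and `χ(5) = −1` is
primitive: its conductor divides `8` but not `4`, as `5 ≡ 1 (mod 4)` (the tree's
`isPrimitive_of_apply_five_eq_neg_one` is the case `R = ℂ`; same proof).
[cite: MontgomeryVaughan2007, §9.1 (primitive characters)] -/
theorem isPrimitive_of_apply_five_eq_neg_one_of_charZero [CharZero R] (χ : DirichletCharacter R 8)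
    (h5 : χ (5 : ZMod 8) = -1) : χ.IsPrimitive := by
  rw [DirichletCharacter.isPrimitive_def]
  have hdvd : χ.conductor ∣ 2 ^ 3 := χ.conductor_dvd_level
  have hnot : ¬ χ.conductor ∣ 4 := by
    intro h4
    have hmem : 4 ∈ χ.conductorSet :=
      (χ.mem_conductorSet_iff_conductor_dvd (show 4 ∣ 8 by norm_num)).mpr h4
    obtain ⟨hd, χ₀, hχ₀⟩ := (χ.mem_conductorSet_iff.mp hmem)
    have hcop : IsCoprime (5 : ℤ) (8 : ℕ) := by
      rw [Int.isCoprime_iff_gcd_eq_one]; decide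
    have h5' : χ (5 : ℤ) = χ₀ (5 : ℤ) := by
      rw [hχ₀, DirichletCharacter.changeLevel_eq_cast_of_dvd' χ₀ hd hcop]
    have h51 : ((5 : ℤ) : ZMod 4) = 1 := by decide
    rw [h51, map_one, show ((5 : ℤ) : ZMod 8) = 5 by rfl, h5] at h5'
    exact Ring.neg_one_ne_one_of_char_ne_two (by rw [ringChar.eq_zero]; norm_num) h5'
  obtain ⟨k, hk, hk'⟩ := (Nat.dvd_prime_pow Nat.prime_two).mp hdvd
  interval_cases k
  · exact absurd (hk' ▸ one_dvd 4) hnot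
  · exact absurd (hk' ▸ (show 2 ∣ 4 by norm_num)) hnot
  · exact absurd (hk' ▸ dvd_refl 4) hnot
  · rw [hk']; norm_num

/-- `χ₈ ⊗ R` is primitive of conductor `8` (`R` of characteristic `0`).
[cite: MontgomeryVaughan2007, §9.1 (primitive characters)] -/
theorem isPrimitive_χ₈_ringHomComp_of_charZero [CharZero R] :
    DirichletCharacter.IsPrimitive (ZMod.χ₈.ringHomComp (Int.castRingHom R)) :=
  isPrimitive_of_apply_five_eq_neg_one_of_charZero R _ (χ₈_ringHomComp_five R)

/-- `χ₈ ⊗ R` has order `2` (`R` of characteristic `0`): `χ₈² = 1`, `χ₈(5) = −1 ≠ 1`.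
[cite: MontgomeryVaughan2007, §9.1] -/
theorem orderOf_χ₈_ringHomComp [CharZero R] :
    orderOf (ZMod.χ₈.ringHomComp (Int.castRingHom R)) = 2 := by
  refine orderOf_eq_prime (ZMod.isQuadratic_χ₈.comp _).sq_eq_one fun h ↦ ?_
  have h5 := χ₈_ringHomComp_five R
  rw [h, MulChar.one_apply (by decide : IsUnit (5 : ZMod 8))] at h5
  exact Ring.neg_one_ne_one_of_char_ne_two (by rw [ringChar.eq_zero]; norm_num) h5.symm

/-- The topological generator of `1 + 4ℤ₂` used by the tree's cyclotomic variable at `p = 2` is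
`γ = 1 + 2² = 5` (`cyclotomicExponent 2 = 2`); a private copy of the tree's
`cyclotomicGenerator_two` (`PAdicLFunctionIntegralityAtTwoProofs`, not imported here). [folklore] -/
private theorem cyclotomicGenerator_two' : cyclotomicGenerator 2 = 5 := by
  simp [cyclotomicGenerator, cyclotomicExponent]

/-- At `p = 2` the conductor-`8` character `χ₈` of `Γ` sits at `T = χ₈(γ) − 1 = χ₈(5) − 1 = −2`.
[cite: MazurTateTeitelbaum1986Invent, §I.13] -/
theorem χ₈_ringHomComp_cyclotomicGenerator_sub_one :
    (ZMod.χ₈.ringHomComp (Int.castRingHom R)) ((cyclotomicGenerator 2 : ℕ) : ZMod (2 ^ 3)) - 1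
      = -2 := by
  rw [cyclotomicGenerator_two']
  have : ((5 : ℕ) : ZMod (2 ^ 3)) = (5 : ZMod 8) := rfl
  rw [this, χ₈_ringHomComp_five]
  norm_num

/-- The `χ₈`-twisted symbol sum with values in any field of characteristic `0` is the image of the
RATIONAL number `S₈(f) = ∑_{a mod 8} χ₈(a) [a/8]⁺_f` (the `ℚ`-valued `ratTwistedSymbolSum`).
[cite: MazurTateTeitelbaum1986Invent, §I.8 (8.6)] -/
theorem ratTwistedSymbolSum_χ₈_eq_cast {N : ℕ} (f : CuspForm (Gamma0 N) 2)
    (K : Type*) [Field K] [CharZero K] :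
    ratTwistedSymbolSum f (ZMod.χ₈.ringHomComp (Int.castRingHom K)) =
      ((ratTwistedSymbolSum f (ZMod.χ₈.ringHomComp (Int.castRingHom ℚ)) : ℚ) : K) := by
  unfold ratTwistedSymbolSum
  rw [Rat.cast_sum]
  refine Finset.sum_congr rfl fun a _ ↦ ?_
  rw [Rat.cast_mul, MulChar.ringHomComp_apply, MulChar.ringHomComp_apply]
  simp

end ChiEight

/-! ### §3 Mazur–Tate–Teitelbaum interpolation at `χ₈`: the value of `L₂(E, T)` at `T = −2` -/

section MTT

variable {W : WeierstrassCurve ℚ} [W.IsElliptic] [W.IsGloballyMinimal]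
  {N : ℕ} [NeZero N] {f : CuspForm (Gamma0 N) 2}

/-- **MTT interpolation at the conductor-`8` character.** For `E/ℚ` (globally minimal `W`) good
ordinary at `2` with newform `f`, unit root `α = unitRoot W 2` and
`L₂(E, T) = padicLFunction f α = ∑ c_k T^k`: the series `∑_k c_k (−2)^k` converges in `ℂ₂` to
`α⁻³ · ∑_{a mod 8} χ₈(a) [a/8]⁺_f` — the interpolation property (MTT §I.14) at the even primitive
character `χ₈ = (2/·)` of conductor `2³`, a character of `Γ = 1 + 4ℤ₂` of order `2` with
`χ₈(γ) = χ₈(5) = −1`, i.e. at `T = χ₈(γ) − 1 = −2` (`= α⁻³ τ(χ₈) L(E, χ₈, 1)/Ω⁺_f` by Birch's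
formula). [cite: MazurTateTeitelbaum1986Invent, §I.14 Proposition (p. 20)] -/
theorem hasSum_coeff_padicLFunction_two_neg_two (hord : IsOrdinaryAt W 2) (hf : IsNewformOf W f) :
    HasSum (fun k : ℕ ↦ algebraMap ℚ_[2] ℂ_[2]
        (PowerSeries.coeff k (padicLFunction f (unitRoot W 2 : ℚ_[2]))) * (-2) ^ k)
      (algebraMap ℚ_[2] ℂ_[2] ((unitRoot W 2 : ℚ_[2])⁻¹ ^ 3) *
        ratTwistedSymbolSum f (ZMod.χ₈.ringHomComp (Int.castRingHom ℂ_[2]))) := by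
  have h := hasSum_coeff_padicLFunction_unitRoot hord hf (m := 3) (by norm_num)
    (ZMod.χ₈.ringHomComp (Int.castRingHom ℂ_[2])) (isPrimitive_χ₈_ringHomComp_of_charZero ℂ_[2])
    (χ₈_ringHomComp_even ℂ_[2]) ⟨1, by rw [pow_one]; exact orderOf_χ₈_ringHomComp ℂ_[2]⟩
  rwa [χ₈_ringHomComp_cyclotomicGenerator_sub_one] at h

end MTT

/-! ### §4 `L(E^{(2)}, 1) = 0` forces `∑_{a mod 8} χ₈(a) [a/8]⁺_f = 0` -/

section Vanishing

variable {W : WeierstrassCurve ℚ} [W.IsElliptic] {N : ℕ} [NeZero N] {f : CuspForm (Gamma0 N) 2}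

omit [W.IsElliptic] in
/-- Good reduction at the prime `2` gives good reduction at the place of `𝓞 ℚ` over `2`
(`hasGoodReductionAtPrime_primesEquiv_iff_holds`). [cite: SilvermanAEC2009, VII.5 Prop. 5.1(a)] -/
theorem hasGoodReductionAt_of_natGenerator_eq_two (hgood : W.HasGoodReductionAtPrime 2)
    (w : HeightOneSpectrum (𝓞 ℚ)) (hw : natGenerator w = 2) : W.HasGoodReductionAt w :=
  (WeierstrassCurve.hasGoodReductionAtPrime_primesEquiv_iff_holds W w 2 hw).mp hgood

/-- **`L(E^{(2)}, 1) = 0` forces `S₈(f) = ∑_{a mod 8} χ₈(a) [a/8]⁺_f = 0`.** For `E/ℚ` elliptic with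
good reduction at `2` and newform `f`: `aₙ(E^{(2)}) = χ₈(n) aₙ(f)` (`LFunction_quadraticTwist_two_apply`),
so `L(E^{(2)}, s) = L(f, χ₈, s)` is entire (`f ⊗ χ₈ ∈ S₂(Γ₀(64N))`), and Birch's formula
(Mazur–Tate–Teitelbaum §I.8 (8.6)) reads `S₈(f) · Ω⁺_f = τ(χ₈) · L(E^{(2)}, 1)`; with `Ω⁺_f > 0`, a
zero of `L(E^{(2)}, s)` at `s = 1` (`analyticRank ≠ 0`) gives `S₈(f) = 0`.
[cite: MazurTateTeitelbaum1986Invent, §I.8 (8.6)] -/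
theorem ratTwistedSymbolSum_χ₈_eq_zero_of_analyticRank_ne_zero (hf : IsNewformOf W f)
    (hgood : W.HasGoodReductionAtPrime 2) (hr : (W.quadraticTwist 2).analyticRank ≠ 0) :
    ratTwistedSymbolSum f (ZMod.χ₈.ringHomComp (Int.castRingHom ℂ)) = 0 := by
  set χ := ZMod.χ₈.ringHomComp (Int.castRingHom ℂ) with hχdef
  have hadd : ∀ v : HeightOneSpectrum (𝓞 ℚ), (primesEquiv v : ℕ) = 2 →
      (W.quadraticTwist 2).HasAdditiveReductionAt v := fun v hv ↦
    (W.hasAdditiveReductionAt_quadraticTwist_two_of_hasGoodReductionAt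
      (hasGoodReductionAt_of_natGenerator_eq_two hgood) v hv).1
  have hco : ∀ n : ℕ, (((W.quadraticTwist 2).LFunction n : ℤ) : ℂ) = χ n * cuspCoeff f n :=
    fun n ↦ by rw [W.LFunction_quadraticTwist_two_apply_complex hadd n, hf.2 n]
  have hE : (W.quadraticTwist 2).HasEntireLFunction :=
    hasEntireLFunction_of_coeff_of_isPrimitive _ f isQuadratic_χ₈_ringHomComp
      isPrimitive_χ₈_ringHomComp hco
  have hL1 : (W.quadraticTwist 2).entireLFunction 1 = 0 :=
    apply_eq_zero_of_analyticOrderNatAt_ne_zero hr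
  have hinv : χ⁻¹ = χ := isQuadratic_χ₈_ringHomComp.inv
  have hBirch := ratTwistedSymbolSum_mul_plusPeriod_holds hf.1 hf.coeffField_eq_bot
    (χ := χ) isPrimitive_χ₈_ringHomComp χ₈_ringHomComp_neg_one
    ((W.quadraticTwist 2).differentiable_entireLFunction hE) (fun s hs ↦ by
      have hs' : (3 / 2 : ℝ) < s.re := by have : (2 : ℝ) < s.re := hs; linarith
      rw [hinv, (W.quadraticTwist 2).entireLFunction_eq_LSeries hE hs',
        LSeries_eq_twistedLSeries_of_coeff _ f χ hco])
  rw [hL1, mul_zero] at hBirch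
  have hΩ : (plusPeriod f : ℂ) ≠ 0 := by
    exact_mod_cast (IsNewform0.plusPeriod_pos_holds hf.1 hf.coeffField_eq_bot).ne'
  exact (mul_eq_zero.mp hBirch).resolve_right hΩ

/-- The rational form: `S₈(f) = 0` in `ℚ` under the same hypotheses.
[cite: MazurTateTeitelbaum1986Invent, §I.8 (8.6)] -/
theorem ratTwistedSymbolSum_χ₈_rat_eq_zero_of_analyticRank_ne_zero (hf : IsNewformOf W f)
    (hgood : W.HasGoodReductionAtPrime 2) (hr : (W.quadraticTwist 2).analyticRank ≠ 0) :
    ratTwistedSymbolSum f (ZMod.χ₈.ringHomComp (Int.castRingHom ℚ)) = 0 := by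
  have h := ratTwistedSymbolSum_χ₈_eq_zero_of_analyticRank_ne_zero hf hgood hr
  rw [ratTwistedSymbolSum_χ₈_eq_cast f ℂ] at h
  exact_mod_cast h

end Vanishing

/-! ### §5 The zero of `L₂(E, T)` at `T = −2` and the divisibility `(T + 2) ∣ g` -/

section ZeroAtMinusTwo

variable {W : WeierstrassCurve ℚ} [W.IsElliptic] [W.IsGloballyMinimal]
  {N : ℕ} [NeZero N] {f : CuspForm (Gamma0 N) 2}

/-- **`L₂(E, −2) = 0` when `L(E^{(2)}, 1) = 0`.** For `E/ℚ` globally minimal, good ordinary at `2`,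
with newform `f` and `ord_{s=1} L(E^{(2)}, s) ≠ 0`: `∑_k c_k (−2)^k = 0` in `ℂ₂`, where
`L₂(E, T) = padicLFunction f (unitRoot W 2) = ∑ c_k T^k` (MTT interpolation at `χ₈`, §3, and the
vanishing of `S₈(f)`, §4). [cite: MazurTateTeitelbaum1986Invent, §I.14 Proposition (p. 20)] -/
theorem hasSum_coeff_padicLFunction_two_neg_two_zero (hord : IsOrdinaryAt W 2)
    (hf : IsNewformOf W f) (hr : (W.quadraticTwist 2).analyticRank ≠ 0) :
    HasSum (fun k : ℕ ↦ algebraMap ℚ_[2] ℂ_[2]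
        (PowerSeries.coeff k (padicLFunction f (unitRoot W 2 : ℚ_[2]))) * (-2) ^ k) 0 := by
  have h := hasSum_coeff_padicLFunction_two_neg_two hord hf
  rwa [ratTwistedSymbolSum_χ₈_eq_cast f ℂ_[2],
    ratTwistedSymbolSum_χ₈_rat_eq_zero_of_analyticRank_ne_zero hf hord.1 hr, Rat.cast_zero,
    mul_zero] at h

/-- `|−2|₂ < 1` in `ℤ₂`. [folklore] -/
private theorem norm_neg_two_lt_one : ‖(-2 : ℤ_[2])‖ < 1 := by
  rw [norm_neg, show (2 : ℤ_[2]) = ((2 : ℕ) : ℤ_[2]) by norm_num, PadicInt.norm_p]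
  norm_num

/-- **The crux `ZeroAtMinusTwo`, member-wise: `(T + 2) ∣ g` for every integral multiple `g` of
`L₂(E, T)`.** Let `E/ℚ` be globally minimal (`W`), good ordinary at `2`, with newform `f`, and
suppose `ord_{s=1} L(E^{(2)}, s) ≠ 0` (e.g. root number `w(E^{(2)}) = −1`), `E^{(2)} = W.quadraticTwist 2`
the twist by `ℚ(√2)`. If `g ∈ ℤ₂⟦T⟧` and `c ∈ ℚ₂` satisfy `g = c · L₂(E, T)` (coefficientwise in
`ℚ₂`), then `(T + 2) ∣ g` in `ℤ₂⟦T⟧`. Proof: `∑_k g_k (−2)^k` converges in `ℤ₂`; its image in `ℂ₂`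
is `c · ∑_k c_k (−2)^k = 0` (§3–§4: MTT interpolation at `χ₈` and `L(E^{(2)}, 1) = 0`); so
`g(−2) = 0` and `T + 2 = T − (−2)` divides `g` (§1).
[cite: MazurTateTeitelbaum1986Invent, §I.14 Proposition (p. 20)] -/
theorem X_add_C_two_dvd_of_analyticRank_quadraticTwist_two_ne_zero (hord : IsOrdinaryAt W 2)
    (hf : IsNewformOf W f) (hr : (W.quadraticTwist 2).analyticRank ≠ 0)
    {c : ℚ_[2]} {g : PowerSeries ℤ_[2]}
    (hg : g.map (PadicInt.Coe.ringHom (p := 2)) =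
      PowerSeries.C c * padicLFunction f (unitRoot W 2 : ℚ_[2])) :
    (PowerSeries.X + PowerSeries.C (2 : ℤ_[2])) ∣ g := by
  -- the series `∑ g_k (−2)^k` converges in `ℤ₂`, to `s` say
  have hs := PadicInt.summable_coeff_mul_pow g norm_neg_two_lt_one
  set s := ∑' k, coeff k g * (-2 : ℤ_[2]) ^ k with hsdef
  -- its image in `ℂ₂` is `c · ∑ c_k (−2)^k = 0`
  set φ : ℤ_[2] →+* ℂ_[2] := (algebraMap ℚ_[2] ℂ_[2]).comp (PadicInt.Coe.ringHom (p := 2))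
    with hφdef
  have hφc : Continuous φ := (continuous_algebraMap ℚ_[2] ℂ_[2]).comp continuous_subtype_val
  have hφapp : ∀ x : ℤ_[2], φ x = algebraMap ℚ_[2] ℂ_[2] (x : ℚ_[2]) := fun _ ↦ rfl
  have hcoeff : ∀ k : ℕ, ((coeff k g : ℤ_[2]) : ℚ_[2]) =
      c * PowerSeries.coeff k (padicLFunction f (unitRoot W 2 : ℚ_[2])) := fun k ↦ by
    have := congrArg (PowerSeries.coeff k) hg
    rwa [PowerSeries.coeff_map, PowerSeries.coeff_C_mul] at this
  have h1 : HasSum (fun k : ℕ ↦ φ (coeff k g * (-2 : ℤ_[2]) ^ k)) (φ s) :=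
    hs.hasSum.map φ hφc
  have hfun : (fun k : ℕ ↦ φ (coeff k g * (-2 : ℤ_[2]) ^ k)) = fun k ↦
      algebraMap ℚ_[2] ℂ_[2] c * (algebraMap ℚ_[2] ℂ_[2]
        (PowerSeries.coeff k (padicLFunction f (unitRoot W 2 : ℚ_[2]))) * (-2) ^ k) := by
    funext k
    rw [map_mul, map_pow, map_neg, map_ofNat, hφapp, hcoeff k, map_mul]
    ring
  have h2 : HasSum (fun k : ℕ ↦ φ (coeff k g * (-2 : ℤ_[2]) ^ k)) 0 := by
    have h0 := (hasSum_coeff_padicLFunction_two_neg_two_zero hord hf hr).mul_left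
      (algebraMap ℚ_[2] ℂ_[2] c)
    rw [mul_zero] at h0
    rwa [hfun]
  have hφs : φ s = 0 := h1.unique h2
  have hs0 : s = 0 := by
    have hinj : Function.Injective φ :=
      (algebraMap ℚ_[2] ℂ_[2]).injective.comp Subtype.val_injective
    exact hinj (by rw [hφs, map_zero])
  have h3 : HasSum (fun k : ℕ ↦ coeff k g * (-2 : ℤ_[2]) ^ k) 0 := hs0 ▸ hs.hasSum
  have h4 := PadicInt.X_sub_C_dvd_of_hasSum_zero norm_neg_two_lt_one h3
  rwa [map_neg, sub_neg_eq_add] at h4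

/-- The same, with the hypothesis in the parity form carried by p2's `RootNumberFacts`
(`ord_{s=1} L(E^{(2)}, s)` odd). [cite: MazurTateTeitelbaum1986Invent, §I.14 Proposition (p. 20)] -/
theorem X_add_C_two_dvd_of_analyticRank_quadraticTwist_two_odd (hord : IsOrdinaryAt W 2)
    (hf : IsNewformOf W f) (hr : (W.quadraticTwist 2).analyticRank % 2 = 1)
    {c : ℚ_[2]} {g : PowerSeries ℤ_[2]}
    (hg : g.map (PadicInt.Coe.ringHom (p := 2)) =
      PowerSeries.C c * padicLFunction f (unitRoot W 2 : ℚ_[2])) :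
    (PowerSeries.X + PowerSeries.C (2 : ℤ_[2])) ∣ g :=
  X_add_C_two_dvd_of_analyticRank_quadraticTwist_two_ne_zero hord hf (by omega) hg

end ZeroAtMinusTwo

end Literature.NumberTheory.EllipticCurves

end
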